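/-
Copyright: the b2b-balaban cell (near-miss cell 7), T⁴-continuum fan-out; row NE7b ROUND-2 swarm, seat
t4-ne7b-formalise-leaf-05 gen 2 (row S6g′ binding of `t4/b2b-balaban-t4-ne7b-p1/LEAVES-NE7b.md`, owner's ruling R-OWNER-22-12 (2)).
Released under the licence of the surrounding project.
-/
import Summits.QuantumFields.BalabanUV.T4Continuum.Support.HistoryJoinsEntropyBudget

/-!
# History joins, part 8: the END IN THE CONSUMER'S SHAPE — `#placements ≤ exp(θm·F)·Λm^{partnerAges}` (row S6g′)

Summits-side support leaf of the T⁴-continuum cell (rung (B)+1 on a FINITE torus only; NOT infinite volume, NOT the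
mass gap, NOT the Clay statement; NOT a proof of the spine estimate NE7b).  Row NE7b, route «COUNT»; row S6g′, the
binding's last composition.  [folklore] real arithmetic over the lineage's own carrier; nothing is quoted from print,
nothing printed is asserted, no `[cite:]` tag, no `Prop` fact of Bałaban's.

WHAT.  §1 the part count is class-linear by name: **`mrg_eq_nmerges`** (`mrg st G = nmerges G`, leaf-02 gen 3's
cluster counts `length_cparts`∕`sum_cparts_nmerges`), `nbirths_le_bsum`, **`mrg_le_bsum`** (`mrg ≤ Σ_births (fat+1) − 1`).
§2 **`card_S_le_exp_pow`**: for every shape tree `G`, with `F := bsum (fat+1) G` (the birth mass WITH multiplicity =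
`Σ_{b ∈ births G′} ((sh b).fat + 1)` of the tagged member, `HistoryJoins.bsum_relabel`), under part 7's displayed laws
and the three CLASS-LINEAR INPUTS stated on part 6's functionals — `MS ≤ κM·F` (row (a)-TOTAL:
`HistoryZoneMassTotal.sum_joins_tparts_zmass_add_le` through `MS_eq_sum_joins`, with `M t P := ⌊zmass t P + γ⌋₊`, under
`Chrono` + `Dated`), `MρP ≤ exp(κρ·F)` (the extent law summed the same way), `ENT ≤ κE·F + μE·partnerAges` (row S6g′(f),
leaf-10 gen 3's sibling-entropy bound) — and the placement fibre `NZ r t s ≤ Mρ r·Λ^{t+1−s}` (row (b)):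
  `#S G z ≤ exp((2 + κM + κρ + κE)·F) · (Λ·e^{μE})^{partnerAges st G}`
— the binder `hlabGTH` shape of `HistoryZoneSurcharge.relWeightBound_lateMergersG_of_irThreshold(H)` with
`θm := 2 + κM + κρ + κE`, `Λm := Λ·e^{μE}`: NO genericity, NO zone factors `Kz^{#merges}·∏ Q^p`.

HONEST SCOPE.  The three class-linear inputs and the zone data∕laws are DISPLAYED hypotheses with named suppliers;
«realised placements are canonically admissible» is the H3 reading side (displayed by design).  `BirthShapeNodup`'s
successor display on the mass road is therefore: `ENT`'s bound (row (f)) + the (a)-TOTAL's `Dated`∕`Chrono` + H3.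
NE7b NOT proved.  HONEST DEPENDENCY (cell): continuum YM on T⁴ ⇐ BetaPertH ∧ nine spine estimates (0/9 proved);
BetaPertH ⇐ (D1) ∧ (D4) ∧ CAP+tail.  This file changes none of it.
-/

open Finset
open Literature.MathematicalPhysics.QuantumFieldTheory.Balaban1983to89
open T4PersistenceDictionary T4PartnerMultiplicity T4BranchingRecordsGas
open Summit.QuantumFields.BalabanUV.T4Continuum.HistoryJoins
open Summit.QuantumFields.BalabanUV.T4Continuum.HistoryJoinsAdm
open Summit.QuantumFields.BalabanUV.T4Continuum.HistoryJoinsCount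
open Summit.QuantumFields.BalabanUV.T4Continuum.HistoryJoinsTotal
open Summit.QuantumFields.BalabanUV.T4Continuum.HistoryJoinsBudget
open Summit.QuantumFields.BalabanUV.T4Continuum.HistoryJoinsEntropyBudget
open Summit.QuantumFields.BalabanUV.T4Continuum.HistoryZoneMassJoins

namespace Summit.QuantumFields.BalabanUV.T4Continuum.HistoryJoinsEnd

noncomputable section

open scoped Classical

variable {ε : Type*} (st : ε → ℕ)

/-! ## §1 The part count is class-linear: `mrg = nmerges ≤ Σ_births (fat + 1) − 1` -/

/-- a list sum as a sum over its indices [folklore] -/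
private theorem sum_map_eq_sum_get' {α N : Type*} [AddCommMonoid N] (l : List α) (g : α → N) :
    (l.map g).sum = ∑ i : Fin l.length, g (l.get i) := by
  induction l with
  | nil => simp
  | cons a l ih =>
      rw [List.map_cons, List.sum_cons, ih]
      show g a + ∑ i : Fin l.length, g (l.get i) = ∑ i : Fin (l.length + 1), g ((a :: l).get i)
      rw [Fin.sum_univ_succ]
      rfl

/-- **THE NON-HOST PART COUNT IS THE MERGE-NODE COUNT.** [folklore] -/
theorem mrg_eq_nmerges : ∀ G : Gen ε, mrg st G = (nmerges G : ℝ)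
  | Gen.born b j => by simp [mrg]
  | Gen.renew G e h => by rw [mrg, nmerges_renew]; exact mrg_eq_nmerges G
  | Gen.merge X Y e => by
      rw [mrg]
      have hlen : npart st (Gen.merge X Y e) = cnodes st (st e) X + cnodes st (st e) Y + 2 := by
        have h1 : (jparts st (Gen.merge X Y e)).length = (tparts st (Gen.merge X Y e)).length := by
          simp [tparts]
        unfold npart
        rw [h1, tparts_merge, List.length_append, length_cparts, length_cparts]
        omega
      have hs : ∑ i : Fin (npart st (Gen.merge X Y e)), mrg st (part st _ i).2 =
          ((((cparts st (st e) X).map nmerges).sum + ((cparts st (st e) Y).map nmerges).sum : ℕ) : ℝ) := by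
        rw [Finset.sum_congr rfl fun i _ => mrg_eq_nmerges (part st (Gen.merge X Y e) i).2]
        have h2 := sum_map_eq_sum_get' (jparts st (Gen.merge X Y e)) fun q => (nmerges q.2 : ℝ)
        unfold npart part
        rw [← h2, sum_jparts_eq_sum_tparts st (fun P => (nmerges P : ℝ)), tparts_merge, List.map_append,
          List.sum_append]
        push_cast
        rw [List.map_map, List.map_map]
        rfl
      have hX := sum_cparts_nmerges st (st e) X
      have hY := sum_cparts_nmerges st (st e) Y
      rw [hs, hlen, nmerges_merge]
      have hX' : ((((cparts st (st e) X).map nmerges).sum : ℕ) : ℝ) + cnodes st (st e) X = nmerges X := by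
        exact_mod_cast hX
      have hY' : ((((cparts st (st e) Y).map nmerges).sum : ℕ) : ℝ) + cnodes st (st e) Y = nmerges Y := by
        exact_mod_cast hY
      push_cast at hX' hY' ⊢
      linarith
termination_by G => gsize G
decreasing_by
  · simp [gsize]
  · exact gsize_lt_of_mem_jparts st _ _ (part_mem st _ i)

/-- the birth count is at most the birth mass [folklore] -/
theorem nbirths_le_bsum (fat : ε → ℕ) : ∀ G : Gen ε, (nbirths G : ℝ) ≤ bsum (fun b => (fat b : ℝ) + 1) G
  | Gen.born b j => by
      simp only [nbirths, bsum, Nat.cast_one]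
      have : (0 : ℝ) ≤ fat b := Nat.cast_nonneg _
      linarith
  | Gen.renew G _ _ => nbirths_le_bsum fat G
  | Gen.merge X Y _ => by
      simp only [nbirths, bsum, Nat.cast_add]
      exact add_le_add (nbirths_le_bsum fat X) (nbirths_le_bsum fat Y)

/-- **`mrg ≤ Σ_births (fat + 1) − 1`**. [folklore] -/
theorem mrg_le_bsum (fat : ε → ℕ) (G : Gen ε) : mrg st G ≤ bsum (fun b => (fat b : ℝ) + 1) G - 1 := by
  rw [mrg_eq_nmerges]
  have h := nmerges_add_one G
  have h' : (nmerges G : ℝ) + 1 = nbirths G := by exact_mod_cast h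
  linarith [nbirths_le_bsum fat G]

/-! ## §2 The END in the consumer's shape -/

variable (M : ℕ → Gen ε → ℕ) (ext : ℕ → Gen ε → ℝ) (NZ : ℝ → ℕ → ℕ → ℕ) (Mρ : ℝ → ℝ)

/-- **ROW S6g′, END IN THE CONSUMER'S SHAPE.**  For every shape tree `G` and root cell `z`, with
`F := Σ_births (fat + 1)` (multiplicity-correct): the canonically admissible junk address placements of `G` with the
root at `z` number at most `exp((2 + κM + κρ + κE)·F) · (Λ·e^{μE})^{partnerAges st G}` — under the displayed zone laws
(cardinality, root locality, one-block root count with fibre `NZ ≤ Mρ·Λ^{t+1−s}`) and the three class-linear inputs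
`MS ≤ κM·F`, `MρP ≤ exp(κρ·F)`, `ENT ≤ κE·F + μE·partnerAges` on part 6's functionals. [folklore] -/
theorem card_S_le_exp_pow {γ β R : Type*} [DecidableEq β] [LinearOrder R] [Fintype γ] {D : ℕ}
    (zone : ℕ → Gen ε → (Addr D → γ) → Finset β) (ρ : (Addr D → γ) → R) (c₀ : γ)
    (near : β → ℕ → γ → ℕ → ℝ → Prop)
    (hcard : ∀ (t : ℕ) (Z : Gen ε) (p : Addr D → γ), p ∈ Sany zone ρ c₀ st Z → (zone t Z p).card ≤ M t Z)
    (hloc : ∀ (t : ℕ) (Z : Gen ε) (p : Addr D → γ) (u : β), p ∈ Sany zone ρ c₀ st Z → u ∈ zone t Z p →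
      near u t (evalA c₀ p (rootAddr Z)) Z.rootStep (ext t Z))
    (hNZ : ∀ (u : β) (t s : ℕ) (r : ℝ), (univ.filter fun y : γ => near u t y s r).card ≤ NZ r t s)
    {Λ : ℝ} (hΛ : 0 ≤ Λ) (hMρ0 : ∀ r, 0 ≤ Mρ r) (hNZle : ∀ (r : ℝ) (t s : ℕ), (NZ r t s : ℝ) ≤ Mρ r * Λ ^ (t + 1 - s))
    (fat : ε → ℕ) (G : Gen ε) {κM κρ κE μE : ℝ}
    (hMS : MS st M G ≤ κM * bsum (fun b => (fat b : ℝ) + 1) G)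
    (hMρP : MρP st ext Mρ G ≤ Real.exp (κρ * bsum (fun b => (fat b : ℝ) + 1) G))
    (hENT : ENT st G ≤ κE * bsum (fun b => (fat b : ℝ) + 1) G + μE * partnerAges st G) (z : γ) :
    ((S zone ρ c₀ st G z).card : ℝ) ≤
      Real.exp ((2 + κM + κρ + κE) * bsum (fun b => (fat b : ℝ) + 1) G) *
        (Λ * Real.exp μE) ^ partnerAges st G := by
  set F := bsum (fun b => (fat b : ℝ) + 1) G
  set pa := partnerAges st G
  have h0 := card_S_le_budgetE st M ext NZ zone ρ c₀ near hcard hloc hNZ G z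
  have hmrg := mrg_le_bsum st fat G
  have hNZP := NZP_le_pow st ext NZ Mρ hΛ hMρ0 hNZle G
  have hMρP0 := MρP_nonneg st ext Mρ hMρ0 G
  -- the exponent of the budget
  have hexp : Real.exp (2 * mrg st G + MS st M G + ENT st G) ≤ Real.exp ((2 + κM + κE) * F + μE * pa) := by
    refine Real.exp_le_exp.2 ?_
    have : 2 * mrg st G ≤ 2 * F := by linarith
    nlinarith [this, hMS, hENT]
  -- assemble
  calc ((S zone ρ c₀ st G z).card : ℝ) ≤ budgetE st M ext NZ G := h0
    _ = Real.exp (2 * mrg st G + MS st M G + ENT st G) * NZP st ext NZ G := rfl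
    _ ≤ Real.exp ((2 + κM + κE) * F + μE * pa) * (MρP st ext Mρ G * Λ ^ pa) :=
        mul_le_mul hexp hNZP (NZP_nonneg st ext NZ G) (Real.exp_pos _).le
    _ ≤ Real.exp ((2 + κM + κE) * F + μE * pa) * (Real.exp (κρ * F) * Λ ^ pa) :=
        mul_le_mul_of_nonneg_left (mul_le_mul_of_nonneg_right hMρP (pow_nonneg hΛ _)) (Real.exp_pos _).le
    _ = Real.exp ((2 + κM + κρ + κE) * F) * (Λ * Real.exp μE) ^ pa := by
        rw [mul_pow, ← Real.exp_nat_mul, ← mul_assoc, ← Real.exp_add, mul_comm (Λ ^ pa), ← mul_assoc,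
          ← Real.exp_add]
        congr 2
        ring

end

end Summit.QuantumFields.BalabanUV.T4Continuum.HistoryJoinsEnd
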